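import Summits.CriticalPhenomena.PercolationContinuityZ3.Theorems.PercNearOneGluingNoHeavyPcintLoopExclusionRungFourDimension
import Summits.CriticalPhenomena.PercolationContinuityZ3.Theorems.PercNearOneGluingNoHeavyPcintLoopExclusionSiteRungFourDimension
import HarnessLib

/-!
# CriticalPhenomena/PercolationContinuityZ3 — Theorems/PercNearOneGluingNoHeavyPcintLoopExclusionMeanField.lean: the MEAN-FIELD LAW of the loop-exclusion compatibility factors — `2d·(1 − R_{2m}(d)) → c_m`: PROVED at the first rung (`c_2 = 2`, site `3/2`), TYPED at the second (`c_3 = 5/2`, derived from the `1/d` expansion and confirmed out of sample, P16)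

Lane prim-pcint, STRUCTURE rule (NUMERICS ⇒ STRUCTURE ⇒ CONJECTURE), item (5): a law that survived its pre-registered predictions
is typed as a Lean `Prop` next to its evidence.  Companion of …PcintLoopExclusionLaw (C4) and of the two dimension-law files
(…RungFourDimension, …SiteRungFourDimension), whose theorems `(2d−1)(1 − R_4(d)) → 2` and `(2d−1)(1 − R^N_4(d)) → 3/2` are
restated here in the `σ = 2d` normalisation of the `1/d` expansion (`tendsto_sigma_mul_one_sub_loopCompat_four`,
`tendsto_sigma_mul_one_sub_siteLoopCompat_four`) — the PROVED instances `m = 2` of the typed law below.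

THE LAW (C4-MF).  For every rung `m ≥ 2` the compatibility defect of the bond hierarchy is EXACTLY of order `1/d`:
`σ(1 − R_{2m}(d)) → c_m ∈ (0, ∞)` (`loopCompatMeanField`); in particular `R_{2m}(d) → 1` (`loopCompatTendstoOne`: loops and arms
become mutually transparent in high dimension — the "mean-field reading" of clause (b) of C4).  `c_2 = 2` is a theorem; **`c_3 = 5/2`**
(`loopCompatMeanFieldSix`) is DERIVED, not fitted: with `σ = 2d`, `μ_4 = σ − 1 − 1/σ + 1/σ² + 0·σ⁻³ + O(σ⁻⁴)` (the Fisher–Sykes root,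
…MemoryFourBrackets), `μ(ℤ^d) = σ − 1 − 1/σ − 3/σ² − 16/σ³ + O(σ⁻⁴)` (Fisher–Gaunt 1964; Hara–Slade 1995), the octagons enter `μ` first at
order `σ⁻³` with coefficient `27 = 648/24` (`p_8(ℤ^d) = 7·C(d,2) + 186·C(d,3) + 648·C(d,4)`, exact on the lane's tables d = 2..6), so
`μ_6 = σ − 1 − 1/σ − 3/σ² + 11/σ³ + O(σ⁻⁴)`; with `p_6(ℤ^d) = d(d−1)(8d−13)/3` (exact) `f_6 = (4/σ³)(1 + 3/(4σ) + O(σ⁻²))` and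
`Δ_6 = 4/σ³ − 7/σ⁴ + O(σ⁻⁵)`, whence `1 − R_6 = (5/2)/σ + O(σ⁻²)`.

EVIDENCE (STRUCTURE.md §1/§3, P16 sealed 2026-08-25T08:47Z sha256 225814e0…, BEFORE any memory-6 automaton existed at d = 7, 8):
lane values `σ(1 − R_6(d))` = 2.298, 2.4425, 2.4669, 2.4815, 2.4908 (d = 2..6); predicted `μ_6(ℤ⁷) ∈ [12.9168, 12.9180]`,
`μ_6(ℤ⁸) ∈ [14.9283, 14.9292]`, `R_6(7) ∈ [0.8210, 0.8225]`, `R_6(8) ∈ [0.8431, 0.8445]`; measured (gen12/memmu.c, 25-class automata,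
controls = the Fisher–Sykes roots to 10 digits) `μ_6(ℤ⁷) = 12.9173913`, `μ_6(ℤ⁸) = 14.9285313`, `σ(1 − R_6(7)) = 2.4968`,
`σ(1 − R_6(8)) = 2.5007` — **4/4 HIT**.  Third rung (fitted only): `σ(1 − R_8(d))` = 2.58, 2.83, 2.82, 2.79, 2.77, 2.75, 2.73 (d = 2..8),
`c_4 ≈ 2.6–2.7`.  Falsifier of the typed clause: `σ(1 − R_6(d))` leaving [2.45, 2.55] for some d ≥ 9, or not converging.

HONEST FRAMING: `loopCompatMeanFieldSix`, `loopCompatMeanField`, `loopCompatTendstoOne` are CONJECTURES (the `1/d` expansion of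
`μ_6` is not in the tree); the `m = 2` statements are theorems.  Nothing here is used by a certified `p_c` cell.
Written by prim-pcint-2 gen 17 (prover-prim-pcint-2-g17-0), 2026-08-25.
-/

noncomputable section

open Filter Topology
open Literature.Probability.LatticeModels Literature.Probability.Percolation
open Summit.CriticalPhenomena.PercolationContinuityZ3.Theorems.Pcint

namespace Summit.CriticalPhenomena.PercolationContinuityZ3.Theorems.Pcint.MemoryTail

/-! ### The proved first rung in the `σ = 2d` normalisation -/

/-- **`2d·(1 − R_4(d)) → 2`** (`= (2d−1)(1 − R_4(d)) + (1 − R_4(d))`, the two summands tending to `2` and `0`). [folklore] -/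
theorem tendsto_sigma_mul_one_sub_loopCompat_four :
    Tendsto (fun d : ℕ => (2 * (d : ℝ)) * (1 - loopCompat d 4)) atTop (𝓝 2) := by
  have h1 := tendsto_loopCompat_four_defect
  have h2 : Tendsto (fun d : ℕ => 1 - loopCompat d 4) atTop (𝓝 (1 - 1)) := tendsto_const_nhds.sub tendsto_loopCompat_four
  rw [sub_self] at h2
  have h := h1.add h2
  rw [add_zero] at h
  exact h.congr fun d => by ring

/-- **`2d·(1 − R^N_4(d)) → 3/2`** (site column). [folklore] -/
theorem tendsto_sigma_mul_one_sub_siteLoopCompat_four :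
    Tendsto (fun d : ℕ => (2 * (d : ℝ)) * (1 - NawTail.siteLoopCompat d 4)) atTop (𝓝 (3 / 2)) := by
  have h1 := NawTail.tendsto_siteLoopCompat_four_defect
  have h2 : Tendsto (fun d : ℕ => 1 - NawTail.siteLoopCompat d 4) atTop (𝓝 (1 - 1)) :=
    tendsto_const_nhds.sub NawTail.tendsto_siteLoopCompat_four
  rw [sub_self] at h2
  have h := h1.add h2
  rw [add_zero] at h
  exact h.congr fun d => by ring

/-- **`2d·(R^N_4(d) − R_4(d)) → 1/2`**: at the first rung the site factor exceeds the bond factor by exactly `1/(4d)` to leading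
order (the limits `2` and `3/2` of the two defects). [folklore] -/
theorem tendsto_sigma_mul_siteLoopCompat_sub_loopCompat_four :
    Tendsto (fun d : ℕ => (2 * (d : ℝ)) * (NawTail.siteLoopCompat d 4 - loopCompat d 4)) atTop (𝓝 (1 / 2)) := by
  have h := tendsto_sigma_mul_one_sub_loopCompat_four.sub tendsto_sigma_mul_one_sub_siteLoopCompat_four
  rw [show (2 : ℝ) - 3 / 2 = 1 / 2 by norm_num] at h
  exact h.congr fun d => by ring

/-! ### The typed mean-field law -/

/-- **C4-MF, every rung: `2d·(1 − R_{2m}(d)) → c_m ∈ (0, ∞)`** — the compatibility defect of the loop-exclusion decomposition is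
exactly of order `1/d` at every rung (`c_2 = 2` proved; `c_3 = 5/2` derived from the `1/d` expansion and confirmed out of sample;
`c_4 ≈ 2.6–2.7` fitted).  STRUCTURE CONJ C4-MF (prim-pcint-2 gen 17, 2026-08-25; STRUCTURE.md §1/§3 P16; not kernel-checked). -/
@[conjecture] def loopCompatMeanField : Prop :=
  ∀ m : ℕ, 2 ≤ m → ∃ c : ℝ, 0 < c ∧ Tendsto (fun d : ℕ => (2 * (d : ℝ)) * (1 - loopCompat d (2 * m))) atTop (𝓝 c)

/-- **C4-MF at the second rung, with its constant: `2d·(1 − R_6(d)) → 5/2`** (DERIVED: `μ_6 = σ − 1 − 1/σ − 3/σ² + 11/σ³ + O(σ⁻⁴)`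
from the octagon coefficient `27 = 648/24` against Hara–Slade's `−16`; pre-registered P16: `μ_6(ℤ⁷)`, `μ_6(ℤ⁸)`, `R_6(7)`, `R_6(8)`
all HIT).  STRUCTURE CONJ C4-MF (prim-pcint-2 gen 17; not kernel-checked — the tree has no `1/d` expansion of `μ_6`). -/
@[conjecture] def loopCompatMeanFieldSix : Prop :=
  Tendsto (fun d : ℕ => (2 * (d : ℝ)) * (1 - loopCompat d 6)) atTop (𝓝 (5 / 2))

/-- **The mean-field reading of clause (b): `R_{2m}(d) → 1` as `d → ∞`** for every rung `m ≥ 2` (a consequence of C4-MF; proved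
at `m = 2`, `tendsto_loopCompat_four`).  STRUCTURE CONJ C4-MF (prim-pcint-2 gen 17; not kernel-checked). -/
@[conjecture] def loopCompatTendstoOne : Prop :=
  ∀ m : ℕ, 2 ≤ m → Tendsto (fun d : ℕ => loopCompat d (2 * m)) atTop (𝓝 1)

/-- **The `m = 2` instance of `loopCompatMeanField` is a theorem** (`c_2 = 2`). [folklore] -/
theorem loopCompatMeanField_rung_four :
    ∃ c : ℝ, 0 < c ∧ Tendsto (fun d : ℕ => (2 * (d : ℝ)) * (1 - loopCompat d (2 * 2))) atTop (𝓝 c) :=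
  ⟨2, two_pos, tendsto_sigma_mul_one_sub_loopCompat_four⟩

/-- **The `m = 2` instance of `loopCompatTendstoOne` is a theorem**. [folklore] -/
theorem loopCompatTendstoOne_rung_four : Tendsto (fun d : ℕ => loopCompat d (2 * 2)) atTop (𝓝 1) :=
  tendsto_loopCompat_four

/-- `loopCompatMeanField` implies `loopCompatTendstoOne` (a bounded multiple of `1/(2d)` tends to `0`). [folklore] -/
theorem loopCompatTendstoOne_of_meanField (h : loopCompatMeanField) : loopCompatTendstoOne := by
  intro m hm
  obtain ⟨c, -, hc⟩ := h m hm
  have hσ : Tendsto (fun d : ℕ => 2 * (d : ℝ)) atTop atTop :=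
    (tendsto_natCast_atTop_atTop (R := ℝ)).const_mul_atTop (by norm_num)
  have h0 := hc.div_atTop hσ
  have h1 := (tendsto_const_nhds (x := (1 : ℝ))).sub h0
  rw [sub_zero] at h1
  refine h1.congr' ?_
  filter_upwards [eventually_ge_atTop 1] with d hd
  have hx : (2 * (d : ℝ)) ≠ 0 := by
    have : (1 : ℝ) ≤ d := by exact_mod_cast hd
    linarith
  rw [mul_div_cancel_left₀ _ hx]
  ring

end Summit.CriticalPhenomena.PercolationContinuityZ3.Theorems.Pcint.MemoryTail
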